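import Literature.Barriers.AtomisticToContinuum.DisorderedHarmonicChainPotential
import Literature.Barriers.AtomisticToContinuum.DisorderedHarmonicChainInvGamma
import Literature.MeasureTheory.Lebesgue.LipschitzShearSubstitution
import Mathlib.Analysis.SpecialFunctions.Trigonometric.ArctanDeriv
import Mathlib.MeasureTheory.Integral.IntervalIntegral.Periodic
import HarnessLib

/-!
# Ajanki–Huveneers 2011, Lemma 5.5 eq. (5.20): concentration of `Tⁿu` — the discharge

Sibling of `DisorderedHarmonicChainPotential.lean` (O. Ajanki, F. Huveneers, *Rigorous scaling law
for the heat current in disordered harmonic chain*, CMP **301** (2011) 841–883, arXiv:1003.1076,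
§5). This file PROVES the named fact `AjankiHuveneers2011_concentration` (Lemma 5.5, eq. (5.20)):
for `R ≥ R₀`, `w ≤ w₀`, `wn ≤ 1`, `y ∈ 𝕋` and `u ∈ L¹_{B(y,w)}(𝕋; ℝ₊)` (bounded Borel
representative), `∫_{B(y-nw, R√w)} Tⁿu ≥ K' ‖u‖₁` — theorem
`AjankiHuveneers2011_concentration_holds`, axioms `propext`, `Classical.choice`, `Quot.sound`.

## The argument (the paper's, with a second moment in place of Azuma's inequality)

The paper (p. 17): by duality `∫_{B} Tⁿu = ∫ u · T*ⁿ χ_B`; the adjoint satisfies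
`T* v(x) ≥ e^{-𝒪(w)} ∫ v(f_b⁻¹(x)) τ(b) db` (5.17); hence `T*ⁿχ_B(z) ≳ ℙ(Y^z_n ∈ B)` for the
reversed chain `Y_n = f_{B_n}⁻¹(Y_{n-1}) = Y_{n-1} - w - wφ(Y_{n-1})B_n + 𝒪(w²)` (5.18), and Azuma's
inequality gives `ℙ(|Y^z_n - (y - nw)| ≥ R√w) ≤ 2e^{-CR²/(nw)}`. Here, all PROVED:

* **`Φ(·, b)` is `𝒪(w)`-Lipschitz** (`ahPhi_lipschitz`, from the `x`-derivative of
  `π⁻¹ arctan(N/D)`, `hasDerivAt_ahPhi`), so `f_b = id + t_b` is a Lipschitz shear of the line with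
  `Lip(t_b) ≤ 12π b_* w < 1`: strictly increasing and onto (`ahStep_strictMono`,
  `ahStep_surjective`), with inverse `ccInv` (`f_b⁻¹`, jointly Borel in `(z, b)`,
  `measurable_ccInv₂`), and — the Jacobian bound behind (5.16)–(5.17) — the change of variables
  holds as the inequality `∫ g ≤ (1 + Lw) ∫ g ∘ f_b` on `[0,∞]`-valued `g`
  (`lintegral_le_mul_lintegral_comp_ahStep`, from
  `Literature.MeasureTheory.Lebesgue.lintegral_one_add_seqDeriv_mul_comp`).
* **Duality as an inequality** (`ccDuality_one`, `ccDuality`): with `T` read on `[0,∞]`-valued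
  functions (`ccT`, equal to `ahT` on bounded Borel `u ≥ 0`, `ccT_iterate_ofReal`) and the
  transition operator `P v(z) = ∫ v(f_b⁻¹(z)) τ(b) db` of the reversed chain (`ccP`),
  `∫ v · Tⁿu ≥ cⁿ ∫ u · Pⁿv`, `c = (1 - ‖h‖_∞ b_* w)/(1 + Lw)` (Tonelli twice per step; no adjoint
  densities are needed).
* **Second moment instead of Azuma** (`ccInv_expansion`, `ccLyapunov_one`, `ccP_iterate_ccQ_le`):
  `f_b⁻¹(z) = z - w - w b sin²(πz) + 𝒪(w²)` and `𝔼B = 0` give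
  `P q_c ≤ (1 + w²) q_{c+w} + C_q w²` for `q_c(z) = (z - c)²`, hence
  `Pⁿ q_{y-nw}(x) ≤ e((x-y)² + C_q nw²) ≤ e(1 + C_q) w` on `B(y, w)`, and by Chebyshev
  `Pⁿ 1_{B(y-nw,R√w)} ≥ 1 - e(1+C_q)/R² ≥ 1/2` for `R² ≥ 2e(1 + C_q)`
  (`ccP_iterate_indicator_ge`). (5.20) asks for no rate in `R`, so the second moment suffices.
* **Assembly**: `∫_{B(y-nw,R√w)} Tⁿu ≥ cⁿ ∫_{B(y,w)} u · Pⁿ1_B ≥ (cⁿ/2) ‖u‖₁`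
  (`ahL1_eq_integral_ball`: `‖u‖₁ = ∫_{(y-w,y+w)} u` by periodicity, `w ≤ 1/2`), and
  `cⁿ ≥ e^{-(2‖h‖_∞ b_* + L)}` because `wn ≤ 1`.

## Faithfulness notes

* Constants: `R₀ = √(2e(C_q + 1))`, `K' = e^{-(2‖h‖_∞ b_* + L)}/2` and `w₀` depend on `τ` and
  `‖h‖_∞` only; in particular `w₀` does NOT depend on `R` (the vendored statement allows it to) —
  on the lift `ℝ` the ball `B(y - nw, R√w)` need not be an arc.
* `h ∈ C¹(𝕋)` is used only through "`h` bounded and Borel" (continuous periodic).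
* The inverse `ccInv w b₋ b₊ b` clamps `b` to `[b₋, b₊]` (immaterial under `τ(b) db`) so that
  `(z, b) ↦ f_b⁻¹(z)` is globally defined and Borel; all statements about it carry the small-`w`
  regime `πw(1 + b_*) ≤ 1/48`.

## Sources

O. Ajanki, F. Huveneers, CMP 301 (2011) 841–883, arXiv:1003.1076: Lemma 3.2 eqs. (3.8)–(3.11),
Cor. 3.4 (i), §5 eqs. (5.3)–(5.5), (5.16)–(5.18), Lemma 5.5 eq. (5.20) and its proof (p. 17).
-/

noncomputable section

open MeasureTheory Real Set
open scoped ENNReal NNReal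

namespace Literature.Barriers.AtomisticToContinuum.HeatConduction

/-! ### The phase correction `Φ(·, b)` is `𝒪(w)`-Lipschitz -/

/-- `∂_x N = π² w b sin 2πx` for the numerator `N = (πw/2)(1 - cos 2πx) b` of (3.10). [folklore] -/
theorem hasDerivAt_ahNum (w b x : ℝ) :
    HasDerivAt (fun x => ahNum w x b) (π ^ 2 * w * b * Real.sin (2 * π * x)) x := by
  have h1 : HasDerivAt (fun y : ℝ => 2 * π * y) (2 * π) x := by
    simpa using (hasDerivAt_id x).const_mul (2 * π)
  have h2 : HasDerivAt (fun y => ahNum w y b)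
      (π * w / 2 * (-(-Real.sin (2 * π * x) * (2 * π))) * b) x :=
    ((h1.cos.const_sub 1).const_mul (π * w / 2)).mul_const b
  exact h2.congr_deriv (by ring)

/-- `∂_x D = -π² w b cos 2πx` for the denominator `D = √(1-(πw/2)²) - (πw/2) sin(2πx) b` of (3.10).
[folklore] -/
theorem hasDerivAt_ahDen (w b x : ℝ) :
    HasDerivAt (fun x => ahDen w x b) (-(π ^ 2 * w * b * Real.cos (2 * π * x))) x := by
  have h1 : HasDerivAt (fun y : ℝ => 2 * π * y) (2 * π) x := by
    simpa using (hasDerivAt_id x).const_mul (2 * π)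
  have h2 : HasDerivAt (fun y => ahDen w y b)
      (-(π * w / 2 * (Real.cos (2 * π * x) * (2 * π)) * b)) x :=
    ((h1.sin.const_mul (π * w / 2)).mul_const b).const_sub (Real.sqrt (1 - (π * w / 2) ^ 2))
  exact h2.congr_deriv (by ring)

/-- The `x`-derivative of `Φ(x, b) = π⁻¹ arctan(N/D)` wherever `D ≠ 0`. [folklore] -/
theorem hasDerivAt_ahPhi {w b x : ℝ} (hD : ahDen w x b ≠ 0) :
    HasDerivAt (fun x => ahPhi w x b)
      (1 / (1 + (ahNum w x b / ahDen w x b) ^ 2) *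
        ((π ^ 2 * w * b * Real.sin (2 * π * x) * ahDen w x b -
            ahNum w x b * (-(π ^ 2 * w * b * Real.cos (2 * π * x)))) / ahDen w x b ^ 2) / π) x := by
  have h := (((hasDerivAt_ahNum w b x).div (hasDerivAt_ahDen w b x) hD).arctan).div_const π
  unfold ahPhi
  exact h

/-- **`Φ(·, b)` is `𝒪(w)`-Lipschitz**: with `M = max(|b₋|, |b₊|)`, for `0 < w` with
`πw(1 + M) ≤ 1/4`, all `b ∈ [b₋, b₊]` and all `x, x'`,
`|Φ(x, b) - Φ(x', b)| ≤ 12πM · w · |x - x'|` (`|∂_x Φ| ≤ 12πMw`: `D ≥ 1/2`, `|D| ≤ 2`,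
`|N| ≤ πwM`, `|∂_x N|, |∂_x D| ≤ π²wM`). [cite: AjankiHuveneers2011, Lemma 3.2 eq. (3.11)] -/
theorem ahPhi_lipschitz {bm bp w : ℝ} (hw0 : 0 < w) (hw : π * w * (1 + max |bm| |bp|) ≤ 1 / 4)
    {b : ℝ} (hb : b ∈ Set.Icc bm bp) (x x' : ℝ) :
    |ahPhi w x b - ahPhi w x' b| ≤ 12 * π * max |bm| |bp| * w * |x - x'| := by
  set M := max |bm| |bp| with hM
  have hM0 : 0 ≤ M := le_max_of_le_left (abs_nonneg _)
  have hbM : |b| ≤ M := ReducedLawHyp.abs_le_of_mem hb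
  have hπ := Real.pi_pos
  have hπ3 := Real.pi_gt_three
  have hπw : 0 ≤ π * w := by positivity
  have hπw1 : π * w ≤ 1 / 4 := (le_mul_of_one_le_right hπw (by linarith)).trans hw
  have hπwM : π * w * M ≤ 1 / 4 :=
    (mul_le_mul_of_nonneg_left (by linarith : M ≤ 1 + M) hπw).trans hw
  have hπwb : π * w * |b| ≤ 1 / 4 := (mul_le_mul_of_nonneg_left hbM hπw).trans hπwM
  have hsq : (π * w / 2) ^ 2 ≤ 1 / 64 := by nlinarith only [hπw1, hπw]
  -- uniform bounds on `N`, `D` and their derivatives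
  have hq1 : Real.sqrt (1 - (π * w / 2) ^ 2) ≤ 1 := by
    calc Real.sqrt (1 - (π * w / 2) ^ 2) ≤ Real.sqrt 1 :=
          Real.sqrt_le_sqrt (by nlinarith only [sq_nonneg (π * w / 2)])
      _ = 1 := Real.sqrt_one
  have hq0 : 1 - (π * w / 2) ^ 2 ≤ Real.sqrt (1 - (π * w / 2) ^ 2) := by
    have hy0 : 0 ≤ 1 - (π * w / 2) ^ 2 := by nlinarith only [hπw1, hπw]
    have hy1 : 1 - (π * w / 2) ^ 2 ≤ 1 := by nlinarith only [sq_nonneg (π * w / 2)]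
    calc 1 - (π * w / 2) ^ 2 = Real.sqrt ((1 - (π * w / 2) ^ 2) ^ 2) := (Real.sqrt_sq hy0).symm
      _ ≤ Real.sqrt (1 - (π * w / 2) ^ 2) := Real.sqrt_le_sqrt (by nlinarith only [hy0, hy1])
  have hDlo : ∀ z, 1 / 2 ≤ ahDen w z b := fun z => by
    rw [ahDen_eq]
    have h1 : |π * w * b * Real.sin (π * z) * Real.cos (π * z)| ≤ π * w * |b| := by
      rw [abs_mul, abs_mul, abs_mul, abs_of_nonneg hπw]
      calc π * w * |b| * |Real.sin (π * z)| * |Real.cos (π * z)| ≤ π * w * |b| * 1 * 1 := by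
            gcongr
            · exact Real.abs_sin_le_one _
            · exact Real.abs_cos_le_one _
        _ = π * w * |b| := by ring
    have h2 := (abs_le.mp h1).2
    linarith only [hq0, h2, hπwb, hsq]
  have hDhi : ∀ z, |ahDen w z b| ≤ 2 := fun z => by
    rw [ahDen_eq]
    have h1 : |π * w * b * Real.sin (π * z) * Real.cos (π * z)| ≤ π * w * |b| := by
      rw [abs_mul, abs_mul, abs_mul, abs_of_nonneg hπw]
      calc π * w * |b| * |Real.sin (π * z)| * |Real.cos (π * z)| ≤ π * w * |b| * 1 * 1 := by
            gcongr
            · exact Real.abs_sin_le_one _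
            · exact Real.abs_cos_le_one _
        _ = π * w * |b| := by ring
    refine (abs_sub _ _).trans ?_
    rw [abs_of_nonneg (Real.sqrt_nonneg _)]
    linarith
  have hNhi : ∀ z, |ahNum w z b| ≤ π * w * M := fun z => by
    rw [ahNum_eq, abs_mul, abs_mul, abs_of_nonneg hπw,
      abs_of_nonneg (sq_nonneg (Real.sin (π * z)))]
    calc π * w * |b| * Real.sin (π * z) ^ 2 ≤ π * w * M * 1 := by
          gcongr
          exact Real.sin_sq_le_one _
      _ = π * w * M := by ring
  have hN'hi : ∀ z, |π ^ 2 * w * b * Real.sin (2 * π * z)| ≤ π ^ 2 * w * M := fun z => by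
    rw [abs_mul, abs_mul, abs_mul, abs_of_nonneg (by positivity : (0:ℝ) ≤ π ^ 2),
      abs_of_nonneg hw0.le]
    calc π ^ 2 * w * |b| * |Real.sin (2 * π * z)| ≤ π ^ 2 * w * M * 1 := by
          gcongr
          exact Real.abs_sin_le_one _
      _ = π ^ 2 * w * M := by ring
  have hD'hi : ∀ z, |(-(π ^ 2 * w * b * Real.cos (2 * π * z)))| ≤ π ^ 2 * w * M := fun z => by
    rw [abs_neg, abs_mul, abs_mul, abs_mul, abs_of_nonneg (by positivity : (0:ℝ) ≤ π ^ 2),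
      abs_of_nonneg hw0.le]
    calc π ^ 2 * w * |b| * |Real.cos (2 * π * z)| ≤ π ^ 2 * w * M * 1 := by
          gcongr
          exact Real.abs_cos_le_one _
      _ = π ^ 2 * w * M := by ring
  -- the derivative bound
  have hderiv : ∀ z, HasDerivAt (fun x => ahPhi w x b)
      (1 / (1 + (ahNum w z b / ahDen w z b) ^ 2) *
        ((π ^ 2 * w * b * Real.sin (2 * π * z) * ahDen w z b -
            ahNum w z b * (-(π ^ 2 * w * b * Real.cos (2 * π * z)))) / ahDen w z b ^ 2) / π) z :=
    fun z => hasDerivAt_ahPhi (by linarith [hDlo z])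
  have hbound : ∀ z, ‖1 / (1 + (ahNum w z b / ahDen w z b) ^ 2) *
      ((π ^ 2 * w * b * Real.sin (2 * π * z) * ahDen w z b -
          ahNum w z b * (-(π ^ 2 * w * b * Real.cos (2 * π * z)))) / ahDen w z b ^ 2) / π‖ ≤
      12 * π * M * w := fun z => by
    have hD0 : 0 < ahDen w z b := by linarith [hDlo z]
    have hD2 : 1 / 4 ≤ ahDen w z b ^ 2 := by nlinarith [hDlo z]
    have hD2pos : 0 < ahDen w z b ^ 2 := by positivity
    have hfac0 : 0 < 1 / (1 + (ahNum w z b / ahDen w z b) ^ 2) := by positivity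
    have hfac1 : 1 / (1 + (ahNum w z b / ahDen w z b) ^ 2) ≤ 1 := by
      rw [div_le_one (by positivity)]
      nlinarith [sq_nonneg (ahNum w z b / ahDen w z b)]
    have hA : |π ^ 2 * w * b * Real.sin (2 * π * z) * ahDen w z b -
        ahNum w z b * (-(π ^ 2 * w * b * Real.cos (2 * π * z)))| ≤ 3 * π ^ 2 * w * M := by
      have h1 : |π ^ 2 * w * b * Real.sin (2 * π * z) * ahDen w z b| ≤ π ^ 2 * w * M * 2 := by
        rw [abs_mul]
        exact mul_le_mul (hN'hi z) (hDhi z) (abs_nonneg _) (by positivity)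
      have h2 : |ahNum w z b * (-(π ^ 2 * w * b * Real.cos (2 * π * z)))| ≤
          π * w * M * (π ^ 2 * w * M) := by
        rw [abs_mul]
        exact mul_le_mul (hNhi z) (hD'hi z) (abs_nonneg _) (by positivity)
      have h3 : π * w * M * (π ^ 2 * w * M) ≤ 1 * (π ^ 2 * w * M) :=
        mul_le_mul_of_nonneg_right (by linarith) (by positivity)
      refine (abs_sub _ _).trans ?_
      linarith
    rw [Real.norm_eq_abs, abs_div, abs_mul, abs_of_pos hfac0, abs_div, abs_of_pos hD2pos,
      abs_of_pos Real.pi_pos]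
    calc 1 / (1 + (ahNum w z b / ahDen w z b) ^ 2) *
          (|π ^ 2 * w * b * Real.sin (2 * π * z) * ahDen w z b -
              ahNum w z b * (-(π ^ 2 * w * b * Real.cos (2 * π * z)))| / ahDen w z b ^ 2) / π
        ≤ 1 * (3 * π ^ 2 * w * M / (1 / 4)) / π := by gcongr
      _ = 12 * π * M * w := by
          field_simp
          ring
  have key := convex_univ.norm_image_sub_le_of_norm_hasDerivWithin_le
    (f := fun x => ahPhi w x b) (fun z _ => (hderiv z).hasDerivWithinAt) (fun z _ => hbound z)
    (Set.mem_univ x') (Set.mem_univ x)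
  rw [Real.norm_eq_abs, Real.norm_eq_abs] at key
  calc |ahPhi w x b - ahPhi w x' b| ≤ 12 * π * M * w * |x - x'| := key
    _ = 12 * π * M * w * |x - x'| := rfl

/-! ### The step `f_b = id + t_b` as a Lipschitz shear; its inverse `f_b⁻¹` -/

section Shear

open Literature.MeasureTheory.Lebesgue

/-- The Lipschitz constant `L = 12π max(|b₋|, |b₊|)` of `Φ(·, b)/w`. [folklore] -/
def ccL (bm bp : ℝ) : ℝ := 12 * π * max |bm| |bp|

/-- The fluctuating part `t_b(x) = ϑ + Φ(x, b)` of the step `f_b = id + t_b`.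
[cite: AjankiHuveneers2011, Lemma 3.2 eq. (3.8)] -/
def ccShift (w b x : ℝ) : ℝ := ahTheta w + ahPhi w x b

/-- Clamping a reduced mass to the support `[b₋, b₊]` of `τ`. [folklore] -/
def ccClamp (bm bp b : ℝ) : ℝ := max bm (min b bp)

/-- **The inverse step `f_b⁻¹`** (`Y_n = f_{B_n}⁻¹(Y_{n-1})`, the reversed chain), for `b` clamped
to `[b₋, b₊]`; a genuine two-sided inverse in the small-`w` regime (`ahStep_ccInv`,
`ccInv_ahStep`). [cite: AjankiHuveneers2011, §5 eqs. (5.16)-(5.18)] -/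
def ccInv (w bm bp b : ℝ) : ℝ → ℝ := Function.invFun (ahStep w (ccClamp bm bp b))

variable {bm bp w b : ℝ}

/-- `L ≥ 0`. [folklore] -/
theorem ccL_nonneg (bm bp : ℝ) : 0 ≤ ccL bm bp := by
  unfold ccL
  have : 0 ≤ max |bm| |bp| := le_max_of_le_left (abs_nonneg _)
  positivity

/-- `f_b = id + t_b`. [cite: AjankiHuveneers2011, Lemma 3.2 eq. (3.8)] -/
theorem ahStep_eq_id_add (w b : ℝ) : ahStep w b = fun x => x + ccShift w b x := by
  funext x
  unfold ahStep ccShift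
  ring

/-- The clamped mass lies in `[b₋, b₊]`. [folklore] -/
theorem ccClamp_mem (h : bm ≤ bp) (b : ℝ) : ccClamp bm bp b ∈ Set.Icc bm bp := by
  unfold ccClamp
  exact ⟨le_max_left _ _, max_le h (min_le_right _ _)⟩

/-- Clamping is the identity on `[b₋, b₊]`. [folklore] -/
theorem ccClamp_of_mem (hb : b ∈ Set.Icc bm bp) : ccClamp bm bp b = b := by
  unfold ccClamp
  rw [min_eq_left hb.2, max_eq_right hb.1]

/-- Clamping is continuous. [folklore] -/
theorem continuous_ccClamp (bm bp : ℝ) : Continuous (ccClamp bm bp) := by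
  unfold ccClamp
  fun_prop

/-- The small-`w` regime of this file: `πw(1 + max(|b₋|,|b₊|)) ≤ 1/48`, which makes `Φ(·,b)`
`1/4`-Lipschitz (`12π M w ≤ 1/4`). [folklore] -/
theorem ccL_mul_le (hw0 : 0 < w) (hw : π * w * (1 + max |bm| |bp|) ≤ 1 / 48) :
    ccL bm bp * w ≤ 1 / 4 := by
  unfold ccL
  have hM0 : 0 ≤ max |bm| |bp| := le_max_of_le_left (abs_nonneg _)
  have hπw : 0 ≤ π * w := by positivity
  have : π * w * max |bm| |bp| ≤ 1 / 48 :=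
    (mul_le_mul_of_nonneg_left (by linarith : max |bm| |bp| ≤ 1 + max |bm| |bp|) hπw).trans hw
  nlinarith

/-- `t_b` is Lipschitz with constant `12πMw` (`b ∈ [b₋, b₊]`, small `w`).
[cite: AjankiHuveneers2011, Lemma 3.2 eq. (3.11)] -/
theorem ccShift_lipschitz (hw0 : 0 < w) (hw : π * w * (1 + max |bm| |bp|) ≤ 1 / 48)
    (hb : b ∈ Set.Icc bm bp) :
    LipschitzWith (Real.toNNReal (ccL bm bp * w)) (ccShift w b) := by
  refine LipschitzWith.of_dist_le_mul fun x x' => ?_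
  rw [Real.dist_eq, Real.dist_eq,
    Real.coe_toNNReal _ (mul_nonneg (ccL_nonneg bm bp) hw0.le)]
  unfold ccShift ccL
  have h := ahPhi_lipschitz hw0 (hw.trans (by norm_num)) hb x x'
  calc |ahTheta w + ahPhi w x b - (ahTheta w + ahPhi w x' b)| = |ahPhi w x b - ahPhi w x' b| := by
        ring_nf
    _ ≤ 12 * π * max |bm| |bp| * w * |x - x'| := h

/-- The Lipschitz constant of `t_b` is `< 1` in the small-`w` regime. [folklore] -/
theorem ccShift_lipschitz_lt_one (hw0 : 0 < w) (hw : π * w * (1 + max |bm| |bp|) ≤ 1 / 48) :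
    Real.toNNReal (ccL bm bp * w) < 1 := by
  rw [Real.toNNReal_lt_one]
  linarith [ccL_mul_le hw0 hw]

/-- `f_b` is strictly increasing (`b ∈ [b₋, b₊]`, small `w`). [cite: AjankiHuveneers2011, Cor. 3.4 (i)] -/
theorem ahStep_strictMono (hw0 : 0 < w) (hw : π * w * (1 + max |bm| |bp|) ≤ 1 / 48)
    (hb : b ∈ Set.Icc bm bp) : StrictMono (ahStep w b) := by
  rw [ahStep_eq_id_add]
  exact strictMono_id_add (ccShift_lipschitz hw0 hw hb) (ccShift_lipschitz_lt_one hw0 hw)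

/-- `f_b` is onto `ℝ` (`b ∈ [b₋, b₊]`, small `w`). [folklore] -/
theorem ahStep_surjective (hw0 : 0 < w) (hw : π * w * (1 + max |bm| |bp|) ≤ 1 / 48)
    (hb : b ∈ Set.Icc bm bp) : Function.Surjective (ahStep w b) := by
  rw [ahStep_eq_id_add]
  exact surjective_id_add (ccShift_lipschitz hw0 hw hb) (ccShift_lipschitz_lt_one hw0 hw)

/-- **Change of variables as an inequality**: `∫ g ≤ (1 + Lw) ∫ g ∘ f_b` for every
`g : ℝ → [0, ∞]` — Lebesgue measure is at most `(1 + Lw)` times its push-forward under `f_b⁻¹`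
(`f_b` is `(1 + Lw)`-Lipschitz; the substitution rule of `LipschitzShearSubstitution`).
[cite: AjankiHuveneers2011, §5 eqs. (5.16)-(5.17)] -/
theorem lintegral_le_mul_lintegral_comp_ahStep (hw0 : 0 < w)
    (hw : π * w * (1 + max |bm| |bp|) ≤ 1 / 48) (hb : b ∈ Set.Icc bm bp) (g : ℝ → ℝ≥0∞) :
    ∫⁻ z, g z ≤ ENNReal.ofReal (1 + ccL bm bp * w) * ∫⁻ x, g (ahStep w b x) := by
  have ht := ccShift_lipschitz hw0 hw hb
  have hK := ccShift_lipschitz_lt_one hw0 hw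
  have hcv := lintegral_one_add_seqDeriv_mul_comp ht hK g
  have hLw : 0 ≤ ccL bm bp * w := mul_nonneg (ccL_nonneg bm bp) hw0.le
  rw [← hcv, ahStep_eq_id_add,
    ← lintegral_const_mul' _ _ ENNReal.ofReal_ne_top]
  refine lintegral_mono fun r => ?_
  refine mul_le_mul' (ENNReal.ofReal_le_ofReal ?_) le_rfl
  have h := (abs_le.mp (abs_seqDeriv_le ht r)).2
  rw [Real.coe_toNNReal _ hLw] at h
  linarith

variable (hbb : bm ≤ bp)
include hbb

/-- `f_b(f_b⁻¹(z)) = z`. [folklore] -/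
theorem ahStep_ccInv (hw0 : 0 < w) (hw : π * w * (1 + max |bm| |bp|) ≤ 1 / 48) (b z : ℝ) :
    ahStep w (ccClamp bm bp b) (ccInv w bm bp b z) = z :=
  Function.invFun_eq (ahStep_surjective hw0 hw (ccClamp_mem hbb b) z)

/-- `f_b⁻¹(f_b(x)) = x`. [folklore] -/
theorem ccInv_ahStep (hw0 : 0 < w) (hw : π * w * (1 + max |bm| |bp|) ≤ 1 / 48) (b x : ℝ) :
    ccInv w bm bp b (ahStep w (ccClamp bm bp b) x) = x :=
  Function.leftInverse_invFun (ahStep_strictMono hw0 hw (ccClamp_mem hbb b)).injective x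

/-- `f_b⁻¹(z) ≤ a ↔ z ≤ f_b(a)`. [folklore] -/
theorem ccInv_le_iff (hw0 : 0 < w) (hw : π * w * (1 + max |bm| |bp|) ≤ 1 / 48) (b z a : ℝ) :
    ccInv w bm bp b z ≤ a ↔ z ≤ ahStep w (ccClamp bm bp b) a := by
  conv_rhs => rw [← ahStep_ccInv hbb hw0 hw b z]
  exact ((ahStep_strictMono hw0 hw (ccClamp_mem hbb b)).le_iff_le).symm

/-- `f_b⁻¹` is monotone. [folklore] -/
theorem ccInv_monotone (hw0 : 0 < w) (hw : π * w * (1 + max |bm| |bp|) ≤ 1 / 48) (b : ℝ) :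
    Monotone (ccInv w bm bp b) := by
  intro z z' hzz'
  rw [ccInv_le_iff hbb hw0 hw, ahStep_ccInv hbb hw0 hw]
  exact hzz'

/-- `(z, b) ↦ f_b⁻¹(z)` is jointly Borel measurable (`{f_b⁻¹(z) ≤ a} = {z ≤ f_b(a)}`). [folklore] -/
theorem measurable_ccInv₂ (hw0 : 0 < w) (hw : π * w * (1 + max |bm| |bp|) ≤ 1 / 48) :
    Measurable fun p : ℝ × ℝ => ccInv w bm bp p.2 p.1 := by
  refine measurable_of_Iic fun a => ?_
  have hset : (fun p : ℝ × ℝ => ccInv w bm bp p.2 p.1) ⁻¹' Set.Iic a =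
      {p : ℝ × ℝ | p.1 ≤ ahStep w (ccClamp bm bp p.2) a} := by
    ext p
    simp only [Set.mem_preimage, Set.mem_Iic, Set.mem_setOf_eq]
    exact ccInv_le_iff hbb hw0 hw p.2 p.1 a
  rw [hset]
  refine measurableSet_le measurable_fst ?_
  have h1 : Measurable fun b : ℝ => ahStep w b a := measurable_ahStep_right w a
  exact h1.comp ((continuous_ccClamp bm bp).measurable.comp measurable_snd)

/-- `z ↦ f_b⁻¹(z)` is measurable. [folklore] -/
theorem measurable_ccInv (hw0 : 0 < w) (hw : π * w * (1 + max |bm| |bp|) ≤ 1 / 48) (b : ℝ) :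
    Measurable (ccInv w bm bp b) :=
  (ccInv_monotone hbb hw0 hw b).measurable

/-- `b ↦ f_b⁻¹(z)` is measurable. [folklore] -/
theorem measurable_ccInv_left (hw0 : 0 < w) (hw : π * w * (1 + max |bm| |bp|) ≤ 1 / 48) (z : ℝ) :
    Measurable fun b => ccInv w bm bp b z := by
  have hz : Measurable fun b : ℝ => (z, b) := measurable_const.prodMk measurable_id
  have : (fun b => ccInv w bm bp b z) = (fun p : ℝ × ℝ => ccInv w bm bp p.2 p.1) ∘ fun b => (z, b) :=
    rfl
  rw [this]
  exact (measurable_ccInv₂ hbb hw0 hw).comp hz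

/-- `f_b⁻¹(f_b(x)) = x` for `b` in the support. [folklore] -/
theorem ccInv_ahStep_of_mem (hw0 : 0 < w) (hw : π * w * (1 + max |bm| |bp|) ≤ 1 / 48)
    (hb : b ∈ Set.Icc bm bp) (x : ℝ) : ccInv w bm bp b (ahStep w b x) = x := by
  have h := ccInv_ahStep hbb hw0 hw b x
  rwa [ccClamp_of_mem hb] at h

/-- `f_b(f_b⁻¹(z)) = z` for `b` in the support. [folklore] -/
theorem ahStep_ccInv_of_mem (hw0 : 0 < w) (hw : π * w * (1 + max |bm| |bp|) ≤ 1 / 48)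
    (hb : b ∈ Set.Icc bm bp) (z : ℝ) : ahStep w b (ccInv w bm bp b z) = z := by
  have h := ahStep_ccInv hbb hw0 hw b z
  rwa [ccClamp_of_mem hb] at h

end Shear

/-! ### `T` and the reversed-chain operator `P` on `ℝ → [0, ∞]`; the duality inequality -/

section Duality

variable {τ : ℝ → ℝ} {bm bp w : ℝ} {h : ℝ → ℝ}

/-- The operator `T` of (5.3) acting on `[0, ∞]`-valued functions (Lebesgue integral version of
`ahT`; equal to it on bounded non-negative `u`, `ccT_ofReal`). [cite: AjankiHuveneers2011, §5 eq. (5.3)] -/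
def ccT (τ : ℝ → ℝ) (w : ℝ) (h : ℝ → ℝ) (u : ℝ → ℝ≥0∞) (x : ℝ) : ℝ≥0∞ :=
  ∫⁻ b, u (ahStep w b x) * ENNReal.ofReal ((1 + w * h x * b) * τ b)

/-- **The transition operator `P v(z) = 𝔼 v(f_B⁻¹(z)) = ∫ v(f_b⁻¹(z)) τ(b) db` of the reversed
chain `Y_n = f_{B_n}⁻¹(Y_{n-1})`** — the lower bound (5.17) of the adjoint `T*` up to `e^{-𝒪(w)}`.
[cite: AjankiHuveneers2011, §5 eqs. (5.17)-(5.18)] -/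
def ccP (τ : ℝ → ℝ) (w bm bp : ℝ) (v : ℝ → ℝ≥0∞) (z : ℝ) : ℝ≥0∞ :=
  ∫⁻ b, v (ccInv w bm bp b z) * ENNReal.ofReal (τ b)

/-- Joint measurability of the integrand of `ccT`. [folklore] -/
theorem measurable_ccT_integrand (hτm : Measurable τ) (hh : Measurable h) {u : ℝ → ℝ≥0∞}
    (hu : Measurable u) :
    Measurable fun p : ℝ × ℝ => u (ahStep w p.2 p.1) * ENNReal.ofReal ((1 + w * h p.1 * p.2) * τ p.2) := by
  refine (hu.comp (measurable_ahStep₂ w)).mul (Measurable.ennreal_ofReal ?_)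
  exact ((measurable_const.add ((measurable_const.mul (hh.comp measurable_fst)).mul
    measurable_snd)).mul (hτm.comp measurable_snd))

/-- `T` preserves measurability. [folklore] -/
theorem measurable_ccT (hτm : Measurable τ) (hh : Measurable h) {u : ℝ → ℝ≥0∞}
    (hu : Measurable u) : Measurable (ccT τ w h u) :=
  (measurable_ccT_integrand hτm hh hu).lintegral_prod_right'

/-- `Tⁿ` preserves measurability. [folklore] -/
theorem measurable_ccT_iterate (hτm : Measurable τ) (hh : Measurable h) {u : ℝ → ℝ≥0∞}
    (hu : Measurable u) : ∀ n, Measurable ((ccT τ w h)^[n] u)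
  | 0 => hu
  | n + 1 => by
    rw [Function.iterate_succ_apply']
    exact measurable_ccT hτm hh (measurable_ccT_iterate hτm hh hu n)

variable (hbb : bm ≤ bp)
include hbb

/-- Joint measurability of the integrand of `ccP`. [folklore] -/
theorem measurable_ccP_integrand (hτm : Measurable τ) (hw0 : 0 < w)
    (hw : π * w * (1 + max |bm| |bp|) ≤ 1 / 48) {v : ℝ → ℝ≥0∞} (hv : Measurable v) :
    Measurable fun p : ℝ × ℝ => v (ccInv w bm bp p.2 p.1) * ENNReal.ofReal (τ p.2) :=
  (hv.comp (measurable_ccInv₂ hbb hw0 hw)).mul (hτm.comp measurable_snd).ennreal_ofReal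

/-- `P` preserves measurability. [folklore] -/
theorem measurable_ccP (hτm : Measurable τ) (hw0 : 0 < w)
    (hw : π * w * (1 + max |bm| |bp|) ≤ 1 / 48) {v : ℝ → ℝ≥0∞} (hv : Measurable v) :
    Measurable (ccP τ w bm bp v) :=
  (measurable_ccP_integrand hbb hτm hw0 hw hv).lintegral_prod_right'

/-- `Pⁿ` preserves measurability. [folklore] -/
theorem measurable_ccP_iterate (hτm : Measurable τ) (hw0 : 0 < w)
    (hw : π * w * (1 + max |bm| |bp|) ≤ 1 / 48) {v : ℝ → ℝ≥0∞} (hv : Measurable v) :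
    ∀ n, Measurable ((ccP τ w bm bp)^[n] v)
  | 0 => hv
  | n + 1 => by
    rw [Function.iterate_succ_apply']
    exact measurable_ccP hbb hτm hw0 hw (measurable_ccP_iterate hτm hw0 hw hv n)

omit hbb in
/-- **One-step duality** `∫ v · Tu ≥ c ∫ u · Pv`, `c = (1 - C_h w)/(1 + Lw)`: the adjoint bound
`T* v ≥ e^{-𝒪(w)} P v` of (5.17) in integrated form (the weight `1 + w h(x) b ≥ 1 - C_h w`, and
the Jacobian of `f_b⁻¹` is `≥ (1 + Lw)⁻¹`). [cite: AjankiHuveneers2011, §5 eqs. (5.16)-(5.17)] -/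
theorem ccDuality_one (hτ : ReducedLawHyp τ bm bp) (hh : Measurable h) {Ch : ℝ}
    (hCh : ∀ x, ∀ b ∈ Set.Icc bm bp, |h x * b| ≤ Ch) (hw0 : 0 < w)
    (hw : π * w * (1 + max |bm| |bp|) ≤ 1 / 48) (hChw : Ch * w ≤ 1) {u v : ℝ → ℝ≥0∞}
    (hu : Measurable u) (hv : Measurable v) :
    ENNReal.ofReal ((1 - Ch * w) / (1 + ccL bm bp * w)) * ∫⁻ z, u z * ccP τ w bm bp v z ≤
      ∫⁻ x, v x * ccT τ w h u x := by
  have hbb : bm ≤ bp := hτ.lt.le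
  have hτm := hτ.measurable
  have hLf : 0 < 1 + ccL bm bp * w := by
    have := mul_nonneg (ccL_nonneg bm bp) hw0.le
    linarith
  have hc₁ : 0 ≤ 1 - Ch * w := by linarith
  -- the integrands of the two double integrals
  have hF : Measurable (Function.uncurry fun (z b : ℝ) =>
      u z * (v (ccInv w bm bp b z) * ENNReal.ofReal (τ b))) :=
    (hu.comp measurable_fst).mul (measurable_ccP_integrand hbb hτm hw0 hw hv)
  have hG : Measurable (Function.uncurry fun (x b : ℝ) =>
      v x * (u (ahStep w b x) * ENNReal.ofReal ((1 + w * h x * b) * τ b))) :=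
    (hv.comp measurable_fst).mul (measurable_ccT_integrand hτm hh hu)
  -- the core: for each fixed `b`
  have hcore : ∀ b, ENNReal.ofReal ((1 - Ch * w) / (1 + ccL bm bp * w)) *
      ∫⁻ z, u z * (v (ccInv w bm bp b z) * ENNReal.ofReal (τ b)) ≤
        ∫⁻ x, v x * (u (ahStep w b x) * ENNReal.ofReal ((1 + w * h x * b) * τ b)) := by
    intro b
    by_cases hb : b ∈ Set.Icc bm bp
    · -- change of variables `z = f_b(x)`
      have hcv := lintegral_le_mul_lintegral_comp_ahStep hw0 hw hb
        (fun z => u z * v (ccInv w bm bp b z))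
      simp only [ccInv_ahStep_of_mem hbb hw0 hw hb] at hcv
      have h1 : ∫⁻ z, u z * (v (ccInv w bm bp b z) * ENNReal.ofReal (τ b)) =
          (∫⁻ z, u z * v (ccInv w bm bp b z)) * ENNReal.ofReal (τ b) := by
        rw [← lintegral_mul_const' _ _ ENNReal.ofReal_ne_top]
        refine lintegral_congr fun z => ?_
        ring
      rw [h1]
      calc ENNReal.ofReal ((1 - Ch * w) / (1 + ccL bm bp * w)) *
            ((∫⁻ z, u z * v (ccInv w bm bp b z)) * ENNReal.ofReal (τ b))
          ≤ ENNReal.ofReal ((1 - Ch * w) / (1 + ccL bm bp * w)) *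
            ((ENNReal.ofReal (1 + ccL bm bp * w) * ∫⁻ x, u (ahStep w b x) * v x) *
              ENNReal.ofReal (τ b)) := by
            gcongr
        _ = ENNReal.ofReal ((1 - Ch * w) * τ b) * ∫⁻ x, u (ahStep w b x) * v x := by
            rw [ENNReal.ofReal_mul hc₁]
            have : ENNReal.ofReal ((1 - Ch * w) / (1 + ccL bm bp * w)) *
                ENNReal.ofReal (1 + ccL bm bp * w) = ENNReal.ofReal (1 - Ch * w) := by
              rw [← ENNReal.ofReal_mul (div_nonneg hc₁ hLf.le), div_mul_cancel₀ _ hLf.ne']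
            rw [← this]
            ring
        _ = ∫⁻ x, ENNReal.ofReal ((1 - Ch * w) * τ b) * (u (ahStep w b x) * v x) := by
            rw [lintegral_const_mul' _ _ ENNReal.ofReal_ne_top]
        _ ≤ ∫⁻ x, v x * (u (ahStep w b x) * ENNReal.ofReal ((1 + w * h x * b) * τ b)) := by
            refine lintegral_mono fun x => ?_
            have hwt : (1 - Ch * w) * τ b ≤ (1 + w * h x * b) * τ b := by
              refine mul_le_mul_of_nonneg_right ?_ (hτ.nonneg b)
              have := (abs_le.mp (hCh x b hb)).1
              nlinarith
            calc ENNReal.ofReal ((1 - Ch * w) * τ b) * (u (ahStep w b x) * v x)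
                ≤ ENNReal.ofReal ((1 + w * h x * b) * τ b) * (u (ahStep w b x) * v x) :=
                  mul_le_mul' (ENNReal.ofReal_le_ofReal hwt) le_rfl
              _ = v x * (u (ahStep w b x) * ENNReal.ofReal ((1 + w * h x * b) * τ b)) := by ring
    · have h0 : τ b = 0 := hτ.eq_zero b hb
      simp [h0]
  -- assemble with Tonelli
  calc ENNReal.ofReal ((1 - Ch * w) / (1 + ccL bm bp * w)) * ∫⁻ z, u z * ccP τ w bm bp v z
      = ENNReal.ofReal ((1 - Ch * w) / (1 + ccL bm bp * w)) *
          ∫⁻ z, ∫⁻ b, u z * (v (ccInv w bm bp b z) * ENNReal.ofReal (τ b)) := by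
        congr 1
        refine lintegral_congr fun z => ?_
        unfold ccP
        rw [lintegral_const_mul]
        exact (hv.comp (measurable_ccInv_left hbb hw0 hw z)).mul hτm.ennreal_ofReal
    _ = ENNReal.ofReal ((1 - Ch * w) / (1 + ccL bm bp * w)) *
          ∫⁻ b, ∫⁻ z, u z * (v (ccInv w bm bp b z) * ENNReal.ofReal (τ b)) := by
        rw [lintegral_lintegral_swap hF.aemeasurable]
    _ = ∫⁻ b, ENNReal.ofReal ((1 - Ch * w) / (1 + ccL bm bp * w)) *
          ∫⁻ z, u z * (v (ccInv w bm bp b z) * ENNReal.ofReal (τ b)) := by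
        rw [lintegral_const_mul' _ _ ENNReal.ofReal_ne_top]
    _ ≤ ∫⁻ b, ∫⁻ x, v x * (u (ahStep w b x) * ENNReal.ofReal ((1 + w * h x * b) * τ b)) :=
        lintegral_mono hcore
    _ = ∫⁻ x, ∫⁻ b, v x * (u (ahStep w b x) * ENNReal.ofReal ((1 + w * h x * b) * τ b)) :=
        (lintegral_lintegral_swap hG.aemeasurable).symm
    _ = ∫⁻ x, v x * ccT τ w h u x := by
        refine lintegral_congr fun x => ?_
        unfold ccT
        rw [lintegral_const_mul]
        have hx : Measurable fun b : ℝ => (x, b) := measurable_const.prodMk measurable_id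
        exact (measurable_ccT_integrand (w := w) hτm hh hu).comp hx

omit hbb in
/-- **`n`-step duality** `∫ v · Tⁿu ≥ cⁿ ∫ u · Pⁿv` (iterate `ccDuality_one`; `T`, `P` preserve
measurability). [cite: AjankiHuveneers2011, §5 proof of (5.20)] -/
theorem ccDuality (hτ : ReducedLawHyp τ bm bp) (hh : Measurable h) {Ch : ℝ}
    (hCh : ∀ x, ∀ b ∈ Set.Icc bm bp, |h x * b| ≤ Ch) (hw0 : 0 < w)
    (hw : π * w * (1 + max |bm| |bp|) ≤ 1 / 48) (hChw : Ch * w ≤ 1) :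
    ∀ (n : ℕ) {u v : ℝ → ℝ≥0∞}, Measurable u → Measurable v →
      ENNReal.ofReal ((1 - Ch * w) / (1 + ccL bm bp * w)) ^ n *
          ∫⁻ z, u z * (ccP τ w bm bp)^[n] v z ≤
        ∫⁻ x, v x * (ccT τ w h)^[n] u x
  | 0, u, v, _, _ => by
    simp only [pow_zero, one_mul, Function.iterate_zero, id_eq]
    exact le_of_eq (lintegral_congr fun z => mul_comm _ _)
  | n + 1, u, v, hu, hv => by
    have hbb : bm ≤ bp := hτ.lt.le
    have hτm := hτ.measurable
    have hPv := measurable_ccP hbb hτm hw0 hw hv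
    have hTn := measurable_ccT_iterate (w := w) hτm hh hu n
    have ih := ccDuality hτ hh hCh hw0 hw hChw n hu hPv
    have h1 := ccDuality_one hτ hh hCh hw0 hw hChw hTn hv
    calc ENNReal.ofReal ((1 - Ch * w) / (1 + ccL bm bp * w)) ^ (n + 1) *
          ∫⁻ z, u z * (ccP τ w bm bp)^[n + 1] v z
        = ENNReal.ofReal ((1 - Ch * w) / (1 + ccL bm bp * w)) *
            (ENNReal.ofReal ((1 - Ch * w) / (1 + ccL bm bp * w)) ^ n *
              ∫⁻ z, u z * (ccP τ w bm bp)^[n] (ccP τ w bm bp v) z) := by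
          rw [pow_succ, Function.iterate_succ_apply]
          ring
      _ ≤ ENNReal.ofReal ((1 - Ch * w) / (1 + ccL bm bp * w)) *
            ∫⁻ x, ccP τ w bm bp v x * (ccT τ w h)^[n] u x := by
          gcongr
      _ = ENNReal.ofReal ((1 - Ch * w) / (1 + ccL bm bp * w)) *
            ∫⁻ x, (ccT τ w h)^[n] u x * ccP τ w bm bp v x := by
          congr 1
          exact lintegral_congr fun x => mul_comm _ _
      _ ≤ ∫⁻ x, v x * ccT τ w h ((ccT τ w h)^[n] u) x := h1
      _ = ∫⁻ x, v x * (ccT τ w h)^[n + 1] u x := by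
          rw [Function.iterate_succ_apply']

end Duality

/-! ### The reversed step `f_b⁻¹(z) = z - w - w b sin²(πz) + 𝒪(w²)` and the one-step Lyapunov bound -/

section Lyapunov

variable {τ : ℝ → ℝ} {bm bp : ℝ}

/-- **The reversed step** (5.18): `f_b⁻¹(z) = z - w - wφ(z) b + 𝒪(w²)`, `φ = sin²(π·)`, and
`|f_b⁻¹(z) - z| = 𝒪(w)`, uniformly in `z` and `b ∈ [b₋, b₊]`.
[cite: AjankiHuveneers2011, §5 eq. (5.18)] -/
theorem ccInv_expansion (hbb : bm ≤ bp) :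
    ∃ w₁ : ℝ, 0 < w₁ ∧ w₁ ≤ 1 ∧ ∃ C₁ : ℝ, 0 ≤ C₁ ∧ ∃ L₁ : ℝ, 0 ≤ L₁ ∧
      ∀ w ∈ Set.Ioc 0 w₁, π * w * (1 + max |bm| |bp|) ≤ 1 / 48 →
        ∀ z : ℝ, ∀ b ∈ Set.Icc bm bp,
          |ccInv w bm bp b z - (z - w - w * b * Real.sin (π * z) ^ 2)| ≤ C₁ * w ^ 2 ∧
          |ccInv w bm bp b z - z| ≤ L₁ * w := by
  obtain ⟨w₁, hw₁, hw₁1, K, hK, L, hL, hd⟩ := ig_ahStep_displacement bm bp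
  set M := max |bm| |bp| with hM
  have hM0 : 0 ≤ M := le_max_of_le_left (abs_nonneg _)
  refine ⟨w₁, hw₁, hw₁1, K + 2 * π * M * L, by positivity, L, hL, ?_⟩
  intro w hw hreg z b hb
  have hw0 : 0 < w := hw.1
  set x := ccInv w bm bp b z with hx
  have hz : ahStep w b x = z := ahStep_ccInv_of_mem hbb hw0 hreg hb z
  obtain ⟨h1, h2⟩ := hd w hw x b hb
  rw [hz] at h1 h2
  have hbM : |b| ≤ M := ReducedLawHyp.abs_le_of_mem hb
  constructor
  · have hsin : |Real.sin (π * z) ^ 2 - Real.sin (π * x) ^ 2| ≤ 2 * π * (L * w) := by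
      have hfac : Real.sin (π * z) ^ 2 - Real.sin (π * x) ^ 2 =
          (Real.sin (π * z) - Real.sin (π * x)) * (Real.sin (π * z) + Real.sin (π * x)) := by ring
      rw [hfac, abs_mul]
      have ha : |Real.sin (π * z) - Real.sin (π * x)| ≤ π * (L * w) := by
        refine (Real.abs_sin_sub_sin_le _ _).trans ?_
        rw [← mul_sub, abs_mul, abs_of_pos Real.pi_pos]
        exact mul_le_mul_of_nonneg_left h2 Real.pi_pos.le
      have hb2 : |Real.sin (π * z) + Real.sin (π * x)| ≤ 2 := by
        refine (abs_add_le _ _).trans ?_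
        have := Real.abs_sin_le_one (π * z)
        have := Real.abs_sin_le_one (π * x)
        linarith
      calc |Real.sin (π * z) - Real.sin (π * x)| * |Real.sin (π * z) + Real.sin (π * x)|
          ≤ π * (L * w) * 2 := mul_le_mul ha hb2 (abs_nonneg _) (by positivity)
        _ = 2 * π * (L * w) := by ring
    have hsplit : x - (z - w - w * b * Real.sin (π * z) ^ 2) =
        -(z - x - w * (1 + b * Real.sin (π * x) ^ 2)) +
          w * b * (Real.sin (π * z) ^ 2 - Real.sin (π * x) ^ 2) := by ring
    rw [hsplit]
    refine (abs_add_le _ _).trans ?_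
    rw [abs_neg, abs_mul, abs_mul, abs_of_pos hw0]
    have h3 : w * |b| * |Real.sin (π * z) ^ 2 - Real.sin (π * x) ^ 2| ≤ w * M * (2 * π * (L * w)) :=
      mul_le_mul (mul_le_mul_of_nonneg_left hbM hw0.le) hsin (abs_nonneg _) (by positivity)
    calc |z - x - w * (1 + b * Real.sin (π * x) ^ 2)| +
          w * |b| * |Real.sin (π * z) ^ 2 - Real.sin (π * x) ^ 2|
        ≤ K * w ^ 2 + w * M * (2 * π * (L * w)) := add_le_add h1 h3
      _ = (K + 2 * π * M * L) * w ^ 2 := by ring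
  · rw [abs_sub_comm]
    exact h2

/-- **One-step Lyapunov bound for the reversed chain**: with `q_c(z) = (z - c)²`,
`P q_c(z) = ∫ (f_b⁻¹(z) - c)² τ(b) db ≤ (1 + w²) q_{c+w}(z) + C_q w²` — the second-moment form of
the martingale step behind (5.18) (`𝔼B = 0` kills the cross term `-2(z-w-c) wφ(z) B`).
[cite: AjankiHuveneers2011, §5 eq. (5.18)] -/
theorem ccLyapunov_one (hτ : ReducedLawHyp τ bm bp) :
    ∃ w₁ : ℝ, 0 < w₁ ∧ w₁ ≤ 1 ∧ ∃ Cq : ℝ, 0 ≤ Cq ∧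
      ∀ w ∈ Set.Ioc 0 w₁, π * w * (1 + max |bm| |bp|) ≤ 1 / 48 →
        ∀ z c : ℝ, Integrable (fun b => (ccInv w bm bp b z - c) ^ 2 * τ b) ∧
          ∫ b, (ccInv w bm bp b z - c) ^ 2 * τ b ≤
            (1 + w ^ 2) * (z - w - c) ^ 2 + Cq * w ^ 2 := by
  have hbb : bm ≤ bp := hτ.lt.le
  obtain ⟨w₁, hw₁, hw₁1, C₁, hC₁, L₁, hL₁, hE⟩ := ccInv_expansion (bm := bm) (bp := bp) hbb
  set M := max |bm| |bp| with hM
  have hM0 : 0 ≤ M := le_max_of_le_left (abs_nonneg _)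
  refine ⟨w₁, hw₁, hw₁1, C₁ ^ 2 + (C₁ + M) ^ 2, by positivity, ?_⟩
  intro w hw hreg z c
  have hw0 : 0 < w := hw.1
  have hw1 : w ≤ 1 := hw.2.trans hw₁1
  set a := z - w - c with ha
  set s := Real.sin (π * z) ^ 2 with hs
  have hs0 : 0 ≤ s := sq_nonneg _
  have hs1 : s ≤ 1 := Real.sin_sq_le_one _
  set α := (1 + w ^ 2) * a ^ 2 + (C₁ ^ 2 + (C₁ + M) ^ 2) * w ^ 2 with hα
  set β := -(2 * a * w * s) with hβ
  -- pointwise bound on the support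
  have hpt : ∀ b ∈ Set.Icc bm bp, (ccInv w bm bp b z - c) ^ 2 ≤ α + β * b := by
    intro b hb
    obtain ⟨h1, -⟩ := hE w hw hreg z b hb
    have hbM : |b| ≤ M := ReducedLawHyp.abs_le_of_mem hb
    set ρ := ccInv w bm bp b z - (z - w - w * b * s) with hρ
    have he : ccInv w bm bp b z - c = a + (ρ - w * b * s) := by rw [hρ, ha]; ring
    rw [he]
    have hρabs : |ρ| ≤ C₁ * w ^ 2 := h1
    -- `2aρ ≤ a²w² + C₁²w²`
    have hcross : 2 * a * ρ ≤ a ^ 2 * w ^ 2 + C₁ ^ 2 * w ^ 2 := by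
      have h3 : 2 * a * ρ ≤ 2 * |a| * (C₁ * w ^ 2) := by
        calc 2 * a * ρ ≤ |2 * a * ρ| := le_abs_self _
          _ = 2 * |a| * |ρ| := by rw [abs_mul, abs_mul, abs_two]
          _ ≤ 2 * |a| * (C₁ * w ^ 2) := by gcongr
      nlinarith [sq_nonneg (|a| * w - C₁ * w), sq_abs a]
    -- `(ρ - wbs)² ≤ w²(C₁ + M)²`
    have hee : (ρ - w * b * s) ^ 2 ≤ w ^ 2 * (C₁ + M) ^ 2 := by
      have h4 : |ρ - w * b * s| ≤ w * (C₁ + M) := by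
        refine (abs_sub _ _).trans ?_
        rw [abs_mul, abs_mul, abs_of_pos hw0, abs_of_nonneg hs0]
        have h5 : w * |b| * s ≤ w * M * 1 := by gcongr
        have hw2 : w ^ 2 ≤ w := by nlinarith
        have h6 : C₁ * w ^ 2 ≤ C₁ * w := mul_le_mul_of_nonneg_left hw2 hC₁
        linarith
      calc (ρ - w * b * s) ^ 2 = |ρ - w * b * s| ^ 2 := (sq_abs _).symm
        _ ≤ (w * (C₁ + M)) ^ 2 := pow_le_pow_left₀ (abs_nonneg _) h4 2
        _ = w ^ 2 * (C₁ + M) ^ 2 := by ring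
    have hexp : (a + (ρ - w * b * s)) ^ 2 = a ^ 2 + 2 * a * ρ + (ρ - w * b * s) ^ 2 + β * b := by
      rw [hβ]; ring
    rw [hexp, hα]
    nlinarith [hcross, hee]
  -- integrate
  have hint_l : Integrable fun b => (ccInv w bm bp b z - c) ^ 2 * τ b := by
    refine hτ.integrable_mul (C := (L₁ * w + |z - c|) ^ 2) ?_ ?_
    · exact ((measurable_ccInv_left hbb hw0 hreg z).sub_const c).pow_const 2
        |>.aestronglyMeasurable
    · intro b hb
      obtain ⟨-, h2⟩ := hE w hw hreg z b hb
      rw [abs_of_nonneg (sq_nonneg _), ← sq_abs]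
      refine pow_le_pow_left₀ (abs_nonneg _) ?_ 2
      calc |ccInv w bm bp b z - c| = |(ccInv w bm bp b z - z) + (z - c)| := by ring_nf
        _ ≤ |ccInv w bm bp b z - z| + |z - c| := abs_add_le _ _
        _ ≤ L₁ * w + |z - c| := by gcongr
  have hint_r : Integrable fun b => (α + β * b) * τ b := by
    have := (hτ.integrable.const_mul α).add (hτ.integrable_id_mul.const_mul β)
    refine this.congr (ae_of_all _ fun b => ?_)
    simp only [Pi.add_apply]
    ring
  refine ⟨hint_l, ?_⟩
  calc ∫ b, (ccInv w bm bp b z - c) ^ 2 * τ b ≤ ∫ b, (α + β * b) * τ b := by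
        refine integral_mono hint_l hint_r fun b => ?_
        by_cases hb : b ∈ Set.Icc bm bp
        · exact mul_le_mul_of_nonneg_right (hpt b hb) (hτ.nonneg b)
        · simp [hτ.eq_zero b hb]
    _ = α := hτ.integral_affine α β
    _ = (1 + w ^ 2) * (z - w - c) ^ 2 + (C₁ ^ 2 + (C₁ + M) ^ 2) * w ^ 2 := by rw [hα]

end Lyapunov

/-! ### Iterating: `Pⁿ 1_{B(y-nw, R√w)} ≥ 1/2` on `B(y, w)` (the rôle of Azuma's inequality) -/

section Concentration

variable {τ : ℝ → ℝ} {bm bp w : ℝ}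

/-- `q_c(z) = (z - c)²` as a `[0, ∞]`-valued function. [folklore] -/
def ccQ (c : ℝ) (z : ℝ) : ℝ≥0∞ := ENNReal.ofReal ((z - c) ^ 2)

/-- `q_c` is Borel. [folklore] -/
theorem measurable_ccQ (c : ℝ) : Measurable (ccQ c) :=
  ((continuous_id.sub continuous_const).pow 2).measurable.ennreal_ofReal

/-- `P` is monotone. [folklore] -/
theorem ccP_mono {f g : ℝ → ℝ≥0∞} (hfg : ∀ y, f y ≤ g y) (z : ℝ) :
    ccP τ w bm bp f z ≤ ccP τ w bm bp g z :=
  lintegral_mono fun _ => mul_le_mul' (hfg _) le_rfl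

/-- `Pⁿ` is monotone. [folklore] -/
theorem ccP_iterate_mono {f g : ℝ → ℝ≥0∞} (hfg : ∀ y, f y ≤ g y) :
    ∀ (n : ℕ) (y : ℝ), (ccP τ w bm bp)^[n] f y ≤ (ccP τ w bm bp)^[n] g y
  | 0, y => hfg y
  | n + 1, y => by
    rw [Function.iterate_succ_apply', Function.iterate_succ_apply']
    exact ccP_mono (ccP_iterate_mono hfg n) y

/-- `P 1 = 1` (`∫ τ = 1`), and more generally `P c = c`. [folklore] -/
theorem ccP_const (hτ : ReducedLawHyp τ bm bp) (r : ℝ≥0∞) (z : ℝ) :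
    ccP τ w bm bp (fun _ => r) z = r := by
  unfold ccP
  rw [lintegral_const_mul r hτ.measurable.ennreal_ofReal,
    ← ofReal_integral_eq_lintegral_ofReal hτ.integrable (ae_of_all _ hτ.nonneg),
    hτ.integral_eq_one, ENNReal.ofReal_one, mul_one]

/-- `Pⁿ c = c`. [folklore] -/
theorem ccP_iterate_const (hτ : ReducedLawHyp τ bm bp) (r : ℝ≥0∞) :
    ∀ n, (ccP τ w bm bp)^[n] (fun _ => r) = fun _ => r
  | 0 => rfl
  | n + 1 => by
    have h1 : ccP τ w bm bp (fun _ => r) = fun _ => r := funext (ccP_const hτ r)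
    rw [Function.iterate_succ_apply, h1]
    exact ccP_iterate_const hτ r n

variable (hbb : bm ≤ bp)
include hbb

/-- `P(f + r g) = Pf + r Pg`. [folklore] -/
theorem ccP_add_mul (hτm : Measurable τ) (hw0 : 0 < w)
    (hw : π * w * (1 + max |bm| |bp|) ≤ 1 / 48) {f g : ℝ → ℝ≥0∞} (hf : Measurable f)
    (hg : Measurable g) (r : ℝ≥0∞) (z : ℝ) :
    ccP τ w bm bp (fun y => f y + r * g y) z = ccP τ w bm bp f z + r * ccP τ w bm bp g z := by
  unfold ccP
  have hmf : Measurable fun b => f (ccInv w bm bp b z) * ENNReal.ofReal (τ b) :=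
    (hf.comp (measurable_ccInv_left hbb hw0 hw z)).mul hτm.ennreal_ofReal
  have hmg : Measurable fun b => g (ccInv w bm bp b z) * ENNReal.ofReal (τ b) :=
    (hg.comp (measurable_ccInv_left hbb hw0 hw z)).mul hτm.ennreal_ofReal
  simp_rw [add_mul]
  rw [lintegral_add_left hmf]
  congr 1
  simp_rw [mul_assoc]
  rw [lintegral_const_mul r hmg]

/-- `Pⁿ(f + r g) = Pⁿf + r Pⁿg`. [folklore] -/
theorem ccP_iterate_add_mul (hτm : Measurable τ) (hw0 : 0 < w)
    (hw : π * w * (1 + max |bm| |bp|) ≤ 1 / 48) {f g : ℝ → ℝ≥0∞} (hf : Measurable f)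
    (hg : Measurable g) (r : ℝ≥0∞) :
    ∀ n, (ccP τ w bm bp)^[n] (fun y => f y + r * g y) =
      fun y => (ccP τ w bm bp)^[n] f y + r * (ccP τ w bm bp)^[n] g y
  | 0 => rfl
  | n + 1 => by
    funext y
    rw [Function.iterate_succ_apply', ccP_iterate_add_mul hτm hw0 hw hf hg r n,
      Function.iterate_succ_apply', Function.iterate_succ_apply']
    exact ccP_add_mul hbb hτm hw0 hw (measurable_ccP_iterate hbb hτm hw0 hw hf n)
      (measurable_ccP_iterate hbb hτm hw0 hw hg n) r y

omit hbb in
/-- One step on the quadratic: `P q_c ≤ C_q w² + (1 + w²) q_{c+w}`.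
[cite: AjankiHuveneers2011, §5 eq. (5.18)] -/
theorem ccP_ccQ_le (hτ : ReducedLawHyp τ bm bp) {w₁ Cq : ℝ} (hCq : 0 ≤ Cq)
    (hL : ∀ w ∈ Set.Ioc 0 w₁, π * w * (1 + max |bm| |bp|) ≤ 1 / 48 →
      ∀ z c : ℝ, Integrable (fun b => (ccInv w bm bp b z - c) ^ 2 * τ b) ∧
        ∫ b, (ccInv w bm bp b z - c) ^ 2 * τ b ≤ (1 + w ^ 2) * (z - w - c) ^ 2 + Cq * w ^ 2)
    (hw : w ∈ Set.Ioc 0 w₁) (hreg : π * w * (1 + max |bm| |bp|) ≤ 1 / 48) (c z : ℝ) :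
    ccP τ w bm bp (ccQ c) z ≤
      ENNReal.ofReal (Cq * w ^ 2) + ENNReal.ofReal (1 + w ^ 2) * ccQ (c + w) z := by
  obtain ⟨hint, hle⟩ := hL w hw hreg z c
  unfold ccP ccQ
  have h1 : ∫⁻ b, ENNReal.ofReal ((ccInv w bm bp b z - c) ^ 2) * ENNReal.ofReal (τ b) =
      ∫⁻ b, ENNReal.ofReal ((ccInv w bm bp b z - c) ^ 2 * τ b) :=
    lintegral_congr fun b => (ENNReal.ofReal_mul (sq_nonneg _)).symm
  rw [h1, ← ofReal_integral_eq_lintegral_ofReal hint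
    (ae_of_all _ fun b => mul_nonneg (sq_nonneg _) (hτ.nonneg b))]
  have h2 : (z - w - c) ^ 2 = (z - (c + w)) ^ 2 := by ring
  calc ENNReal.ofReal (∫ b, (ccInv w bm bp b z - c) ^ 2 * τ b)
      ≤ ENNReal.ofReal ((1 + w ^ 2) * (z - w - c) ^ 2 + Cq * w ^ 2) := ENNReal.ofReal_le_ofReal hle
    _ = ENNReal.ofReal (Cq * w ^ 2) +
          ENNReal.ofReal (1 + w ^ 2) * ENNReal.ofReal ((z - (c + w)) ^ 2) := by
        rw [ENNReal.ofReal_add (by positivity) (by positivity), ENNReal.ofReal_mul (by positivity),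
          h2, add_comm]

/-- **`n` steps on the quadratic**: `Pⁿ q_c ≤ n C_q w² (1+w²)ⁿ + (1+w²)ⁿ q_{c+nw}` — the variance of
the reversed chain after `n` steps is `𝒪(nw²)` around the drifted centre `c + nw`.
[cite: AjankiHuveneers2011, §5 eq. (5.18)] -/
theorem ccP_iterate_ccQ_le (hτ : ReducedLawHyp τ bm bp) {w₁ Cq : ℝ} (hCq : 0 ≤ Cq)
    (hL : ∀ w ∈ Set.Ioc 0 w₁, π * w * (1 + max |bm| |bp|) ≤ 1 / 48 →
      ∀ z c : ℝ, Integrable (fun b => (ccInv w bm bp b z - c) ^ 2 * τ b) ∧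
        ∫ b, (ccInv w bm bp b z - c) ^ 2 * τ b ≤ (1 + w ^ 2) * (z - w - c) ^ 2 + Cq * w ^ 2)
    (hw : w ∈ Set.Ioc 0 w₁) (hreg : π * w * (1 + max |bm| |bp|) ≤ 1 / 48) :
    ∀ (k : ℕ) (c z : ℝ), (ccP τ w bm bp)^[k] (ccQ c) z ≤
      ENNReal.ofReal (k * Cq * w ^ 2 * (1 + w ^ 2) ^ k) +
        ENNReal.ofReal ((1 + w ^ 2) ^ k) * ccQ (c + k * w) z
  | 0, c, z => by
    simp only [Function.iterate_zero, id_eq, Nat.cast_zero, zero_mul, ENNReal.ofReal_zero,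
      zero_add, pow_zero, ENNReal.ofReal_one, one_mul, add_zero, le_refl]
  | k + 1, c, z => by
    have hw0 : 0 < w := hw.1
    have hτm := hτ.measurable
    have ih : ∀ y, (ccP τ w bm bp)^[k] (ccQ c) y ≤
        (fun y => ENNReal.ofReal (k * Cq * w ^ 2 * (1 + w ^ 2) ^ k) +
          ENNReal.ofReal ((1 + w ^ 2) ^ k) * ccQ (c + k * w) y) y :=
      fun y => ccP_iterate_ccQ_le hτ hCq hL hw hreg k c y
    have hA : ENNReal.ofReal ((1 + w ^ 2) ^ k) * ENNReal.ofReal (1 + w ^ 2) =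
        ENNReal.ofReal ((1 + w ^ 2) ^ (k + 1)) := by
      rw [← ENNReal.ofReal_mul (by positivity), ← pow_succ]
    have hB : ENNReal.ofReal (k * Cq * w ^ 2 * (1 + w ^ 2) ^ k) +
        ENNReal.ofReal ((1 + w ^ 2) ^ k) * ENNReal.ofReal (Cq * w ^ 2) ≤
          ENNReal.ofReal ((k + 1 : ℕ) * Cq * w ^ 2 * (1 + w ^ 2) ^ (k + 1)) := by
      rw [← ENNReal.ofReal_mul (by positivity),
        ← ENNReal.ofReal_add (by positivity) (by positivity)]
      refine ENNReal.ofReal_le_ofReal ?_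
      have hA1 : (1 + w ^ 2) ^ k ≤ (1 + w ^ 2) ^ (k + 1) :=
        pow_le_pow_right₀ (by nlinarith) (Nat.le_succ k)
      push_cast
      calc k * Cq * w ^ 2 * (1 + w ^ 2) ^ k + (1 + w ^ 2) ^ k * (Cq * w ^ 2)
          = (k + 1) * Cq * w ^ 2 * (1 + w ^ 2) ^ k := by ring
        _ ≤ (k + 1) * Cq * w ^ 2 * (1 + w ^ 2) ^ (k + 1) :=
            mul_le_mul_of_nonneg_left hA1 (by positivity)
    have hc : c + k * w + w = c + ((k + 1 : ℕ) : ℝ) * w := by push_cast; ring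
    rw [Function.iterate_succ_apply']
    calc ccP τ w bm bp ((ccP τ w bm bp)^[k] (ccQ c)) z
        ≤ ccP τ w bm bp (fun y => ENNReal.ofReal (k * Cq * w ^ 2 * (1 + w ^ 2) ^ k) +
            ENNReal.ofReal ((1 + w ^ 2) ^ k) * ccQ (c + k * w) y) z := ccP_mono ih z
      _ = ENNReal.ofReal (k * Cq * w ^ 2 * (1 + w ^ 2) ^ k) +
            ENNReal.ofReal ((1 + w ^ 2) ^ k) * ccP τ w bm bp (ccQ (c + k * w)) z := by
          rw [ccP_add_mul hbb hτm hw0 hreg measurable_const (measurable_ccQ _), ccP_const hτ]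
      _ ≤ ENNReal.ofReal (k * Cq * w ^ 2 * (1 + w ^ 2) ^ k) +
            ENNReal.ofReal ((1 + w ^ 2) ^ k) *
              (ENNReal.ofReal (Cq * w ^ 2) +
                ENNReal.ofReal (1 + w ^ 2) * ccQ (c + k * w + w) z) := by
          gcongr
          exact ccP_ccQ_le hτ hCq hL hw hreg _ _
      _ = (ENNReal.ofReal (k * Cq * w ^ 2 * (1 + w ^ 2) ^ k) +
            ENNReal.ofReal ((1 + w ^ 2) ^ k) * ENNReal.ofReal (Cq * w ^ 2)) +
              ENNReal.ofReal ((1 + w ^ 2) ^ k) * ENNReal.ofReal (1 + w ^ 2) *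
                ccQ (c + k * w + w) z := by ring
      _ ≤ ENNReal.ofReal ((k + 1 : ℕ) * Cq * w ^ 2 * (1 + w ^ 2) ^ (k + 1)) +
            ENNReal.ofReal ((1 + w ^ 2) ^ (k + 1)) * ccQ (c + ((k + 1 : ℕ) : ℝ) * w) z := by
          rw [hA, hc]
          exact add_le_add hB le_rfl

omit hbb in
/-- **Concentration of the reversed chain** (the estimate (5.18)–(5.20) of the paper, there by
Azuma's inequality): for `2e(C_q + 1) ≤ R²`, `wn ≤ 1` and `|x - y| < w`,
`Pⁿ 1_{B(y - nw, R√w)}(x) ≥ 1/2`, i.e. `ℙ(|Y^x_n - (y - nw)| ≥ R√w) ≤ 1/2` (here by Chebyshev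
on the iterated Lyapunov bound). [cite: AjankiHuveneers2011, Lemma 5.5, proof of (5.20)] -/
theorem ccP_iterate_indicator_ge (hτ : ReducedLawHyp τ bm bp) {w₁ Cq : ℝ} (hCq : 0 ≤ Cq)
    (hw₁1 : w₁ ≤ 1)
    (hL : ∀ w ∈ Set.Ioc 0 w₁, π * w * (1 + max |bm| |bp|) ≤ 1 / 48 →
      ∀ z c : ℝ, Integrable (fun b => (ccInv w bm bp b z - c) ^ 2 * τ b) ∧
        ∫ b, (ccInv w bm bp b z - c) ^ 2 * τ b ≤ (1 + w ^ 2) * (z - w - c) ^ 2 + Cq * w ^ 2)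
    (hw : w ∈ Set.Ioc 0 w₁) (hreg : π * w * (1 + max |bm| |bp|) ≤ 1 / 48) {R : ℝ} (hR0 : 0 < R)
    (hR : 2 * Real.exp 1 * (Cq + 1) ≤ R ^ 2) {n : ℕ} (hn : w * n ≤ 1) {y x : ℝ}
    (hx : |x - y| < w) :
    2⁻¹ ≤ (ccP τ w bm bp)^[n]
      ((Set.Ioo (y - n * w - R * Real.sqrt w) (y - n * w + R * Real.sqrt w)).indicator 1) x := by
  have hbb : bm ≤ bp := hτ.lt.le
  have hτm := hτ.measurable
  have hw0 : 0 < w := hw.1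
  have hw1 : w ≤ 1 := hw.2.trans hw₁1
  set c₀ := y - n * w with hc₀
  set I := Set.Ioo (c₀ - R * Real.sqrt w) (c₀ + R * Real.sqrt w) with hI
  set r : ℝ≥0∞ := ENNReal.ofReal ((R ^ 2 * w)⁻¹) with hr
  have hRw : 0 < R ^ 2 * w := by positivity
  have hsq : (R * Real.sqrt w) ^ 2 = R ^ 2 * w := by rw [mul_pow, Real.sq_sqrt hw0.le]
  have hRs : 0 ≤ R * Real.sqrt w := by positivity
  -- pointwise: `1 ≤ 1_I + r q_{c₀}`
  have hpt : ∀ z, (fun _ => (1 : ℝ≥0∞)) z ≤ (fun z => I.indicator 1 z + r * ccQ c₀ z) z := by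
    intro z
    by_cases hz : z ∈ I
    · simp only [Set.indicator_of_mem hz, Pi.one_apply]
      exact le_self_add
    · simp only [Set.indicator_of_notMem hz, zero_add]
      have hz' : R ^ 2 * w ≤ (z - c₀) ^ 2 := by
        rw [hI, Set.mem_Ioo, not_and_or, not_lt, not_lt] at hz
        rw [← hsq]
        rcases hz with hz | hz
        · nlinarith
        · nlinarith
      show 1 ≤ r * ENNReal.ofReal ((z - c₀) ^ 2)
      rw [hr, ← ENNReal.ofReal_mul (by positivity), ← ENNReal.ofReal_one]
      refine ENNReal.ofReal_le_ofReal ?_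
      rw [inv_mul_eq_div, le_div_iff₀ hRw, one_mul]
      exact hz'
  have hmI : Measurable (I.indicator (1 : ℝ → ℝ≥0∞)) :=
    measurable_one.indicator measurableSet_Ioo
  have h1 : (1 : ℝ≥0∞) ≤ (ccP τ w bm bp)^[n] (I.indicator 1) x +
      r * (ccP τ w bm bp)^[n] (ccQ c₀) x := by
    have hmono := ccP_iterate_mono (τ := τ) (w := w) (bm := bm) (bp := bp) hpt n x
    rw [ccP_iterate_const hτ 1 n,
      ccP_iterate_add_mul hbb hτm hw0 hreg hmI (measurable_ccQ c₀) r n] at hmono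
    exact hmono
  -- the error term is at most `1/2`
  have hQ := ccP_iterate_ccQ_le hbb hτ hCq hL hw hreg n c₀ x
  have hcy : c₀ + n * w = y := by rw [hc₀]; ring
  rw [hcy] at hQ
  have hQy : ccQ y x ≤ ENNReal.ofReal (w ^ 2) := by
    unfold ccQ
    refine ENNReal.ofReal_le_ofReal ?_
    have h := abs_lt.mp hx
    nlinarith
  have hAn : (1 + w ^ 2) ^ n ≤ Real.exp 1 := by
    calc (1 + w ^ 2) ^ n ≤ (Real.exp (w ^ 2)) ^ n :=
          pow_le_pow_left₀ (by positivity) (by linarith [Real.add_one_le_exp (w ^ 2)]) n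
      _ = Real.exp (n * w ^ 2) := (Real.exp_nat_mul _ _).symm
      _ ≤ Real.exp 1 := Real.exp_le_exp.mpr (by nlinarith)
  have hreal : (R ^ 2 * w)⁻¹ * (n * Cq * w ^ 2 * (1 + w ^ 2) ^ n + (1 + w ^ 2) ^ n * w ^ 2) ≤
      1 / 2 := by
    rw [inv_mul_le_iff₀ hRw]
    have hA0 : 0 ≤ (1 + w ^ 2) ^ n := by positivity
    have h2 : n * w * Cq + w ≤ Cq + 1 := by nlinarith
    calc n * Cq * w ^ 2 * (1 + w ^ 2) ^ n + (1 + w ^ 2) ^ n * w ^ 2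
        = (1 + w ^ 2) ^ n * (n * w * Cq + w) * w := by ring
      _ ≤ Real.exp 1 * (Cq + 1) * w := by
          refine mul_le_mul_of_nonneg_right ?_ hw0.le
          exact mul_le_mul hAn h2 (by positivity) (by positivity)
      _ ≤ R ^ 2 * w * (1 / 2) := by nlinarith
  have hD : r * (ENNReal.ofReal (n * Cq * w ^ 2 * (1 + w ^ 2) ^ n) +
      ENNReal.ofReal ((1 + w ^ 2) ^ n) * ccQ y x) ≤ 2⁻¹ := by
    calc r * (ENNReal.ofReal (n * Cq * w ^ 2 * (1 + w ^ 2) ^ n) +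
          ENNReal.ofReal ((1 + w ^ 2) ^ n) * ccQ y x)
        ≤ r * (ENNReal.ofReal (n * Cq * w ^ 2 * (1 + w ^ 2) ^ n) +
            ENNReal.ofReal ((1 + w ^ 2) ^ n) * ENNReal.ofReal (w ^ 2)) := by gcongr
      _ = ENNReal.ofReal ((R ^ 2 * w)⁻¹ *
            (n * Cq * w ^ 2 * (1 + w ^ 2) ^ n + (1 + w ^ 2) ^ n * w ^ 2)) := by
          rw [hr, ← ENNReal.ofReal_mul (by positivity),
            ← ENNReal.ofReal_add (by positivity) (by positivity),
            ← ENNReal.ofReal_mul (by positivity)]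
      _ ≤ ENNReal.ofReal (1 / 2) := ENNReal.ofReal_le_ofReal hreal
      _ = 2⁻¹ := by rw [one_div, ENNReal.ofReal_inv_of_pos two_pos, ENNReal.ofReal_ofNat]
  have h2 : (1 : ℝ≥0∞) ≤ (ccP τ w bm bp)^[n] (I.indicator 1) x + 2⁻¹ :=
    h1.trans (add_le_add le_rfl ((mul_le_mul' le_rfl hQ).trans hD))
  calc (2⁻¹ : ℝ≥0∞) = 1 - 2⁻¹ := ENNReal.one_sub_inv_two.symm
    _ ≤ (ccP τ w bm bp)^[n] (I.indicator 1) x := tsub_le_iff_right.mpr h2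

end Concentration

/-! ### Bridge to the Bochner-integral operator `ahT`: measurability, `‖T‖_{∞→∞} = 1`, `ccT = T` -/

section Bridge

variable {τ : ℝ → ℝ} {bm bp w : ℝ} {h : ℝ → ℝ}

/-- **`ccT` is `T`** on bounded Borel `u ≥ 0` (non-negative weights, `w ‖h‖_∞ b_* ≤ 1`):
`ccT (ofReal ∘ u) = ofReal ∘ (T u)`. [cite: AjankiHuveneers2011, §5 eq. (5.3)] -/
theorem ccT_ofReal (hτ : ReducedLawHyp τ bm bp) {H : ℝ} (hH : ∀ x, |h x| ≤ H) (hw0 : 0 ≤ w)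
    (hwH : w * H * max |bm| |bp| ≤ 1) {u : ℝ → ℝ} (hu : Measurable u) {Mu : ℝ}
    (hu0 : ∀ z, 0 ≤ u z) (huM : ∀ z, |u z| ≤ Mu) (x : ℝ) :
    ccT τ w h (fun z => ENNReal.ofReal (u z)) x = ENNReal.ofReal (ahT τ w h u x) := by
  have hint := integrable_ahT_integrand hτ hu huM w h x
  have hnn : 0 ≤ᵐ[volume] fun b => u (ahStep w b x) * ((1 + w * h x * b) * τ b) := by
    refine ae_of_all _ fun b => ?_
    by_cases hb : b ∈ Set.Icc bm bp
    · have hwt : 0 ≤ 1 + w * h x * b := by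
        linarith [(abs_le.mp ((abs_weightArg_le (x := x) hw0 hH hb).trans hwH)).1]
      exact mul_nonneg (hu0 _) (mul_nonneg hwt (hτ.nonneg b))
    · simp [hτ.eq_zero b hb]
  unfold ccT ahT
  rw [ofReal_integral_eq_lintegral_ofReal hint hnn]
  exact lintegral_congr fun b => (ENNReal.ofReal_mul (hu0 _)).symm

/-- **The iterates agree: `ccTⁿ (ofReal ∘ u) = ofReal ∘ Tⁿu`** for non-negative bounded Borel `u`.
[cite: AjankiHuveneers2011, §5 eq. (5.4)] -/
theorem ccT_iterate_ofReal (hτ : ReducedLawHyp τ bm bp) (hh : Measurable h) {H : ℝ}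
    (hH : ∀ x, |h x| ≤ H) (hw0 : 0 ≤ w) (hwH : w * H * max |bm| |bp| ≤ 1) {u : ℝ → ℝ}
    (hu : Measurable u) (hub : ∃ M, ∀ z, |u z| ≤ M) (hu0 : ∀ z, 0 ≤ u z) :
    ∀ n, (ccT τ w h)^[n] (fun z => ENNReal.ofReal (u z)) =
      fun z => ENNReal.ofReal ((ahT τ w h)^[n] u z)
  | 0 => rfl
  | n + 1 => by
    obtain ⟨hm, ⟨M, hM⟩, h0⟩ := ahT_iterate_closure hτ hh hH hw0 hwH hu hub hu0 n
    rw [Function.iterate_succ_apply', Function.iterate_succ_apply',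
      ccT_iterate_ofReal hτ hh hH hw0 hwH hu hub hu0 n]
    funext z
    exact ccT_ofReal hτ hH hw0 hwH hm h0 hM z

/-- **`‖u‖₁ = ∫_{B(y,w)} u`** for `u ∈ L¹_{B(y,w)}(𝕋; ℝ₊)` (bounded Borel representative) and
`w ≤ 1/2`: the `L¹(𝕋)` norm over one period is the integral over the lifted arc `(y - w, y + w)`.
[cite: AjankiHuveneers2011, §5 (norms `‖·‖_p` on `L^p(𝕋)`)] -/
theorem ahL1_eq_integral_ball {u : ℝ → ℝ} {y w : ℝ} (hu : AHBallFn u y w) (hw : w ≤ 1 / 2) :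
    ahL1 u = ∫ z in Set.Ioo (y - w) (y + w), u z := by
  unfold ahL1
  have h1 : ∫ z in Set.Ico (0 : ℝ) 1, |u z| = ∫ z in Set.Ico (0 : ℝ) 1, u z :=
    setIntegral_congr_fun measurableSet_Ico fun z _ => abs_of_nonneg (hu.nonneg z)
  have h2 : ∫ z in Set.Ico (0 : ℝ) 1, u z = ∫ z in (0 : ℝ)..1, u z := by
    rw [intervalIntegral.integral_of_le zero_le_one, integral_Ico_eq_integral_Ioo,
      integral_Ioc_eq_integral_Ioo]
  have h3 : ∫ z in (0 : ℝ)..1, u z = ∫ z in (y - 1 / 2)..(y - 1 / 2 + 1), u z := by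
    have := hu.periodic.intervalIntegral_add_eq 0 (y - 1 / 2)
    rwa [zero_add] at this
  have h4 : ∫ z in (y - 1 / 2)..(y - 1 / 2 + 1), u z = ∫ z in Set.Ioc (y - 1 / 2) (y - 1 / 2 + 1), u z :=
    intervalIntegral.integral_of_le (by linarith)
  rw [h1, h2, h3, h4]
  refine setIntegral_eq_of_subset_of_forall_sdiff_eq_zero measurableSet_Ioc ?_ ?_
  · intro z hz
    exact ⟨by linarith [hz.1], by linarith [hz.2]⟩
  · intro z hz
    by_contra hne
    obtain ⟨k, hk⟩ := hu.support z hne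
    have hzy : |z - y| ≤ 1 / 2 := abs_le.mpr ⟨by linarith [hz.1.1], by linarith [hz.1.2]⟩
    have hk1 : |(k : ℝ)| < 1 := by
      have : |(k : ℝ)| ≤ |z - y| + |z - y - k| := by
        have := abs_sub (z - y) (z - y - k)
        rwa [show z - y - (z - y - k) = k by ring] at this
      linarith
    have hk0 : k = 0 := by
      have h5 := abs_lt.mp hk1
      have h6 : (k : ℝ) < 1 := h5.2
      have h7 : (-1 : ℝ) < k := h5.1
      have h8 : k < 1 := by exact_mod_cast h6
      have h9 : -1 < k := by exact_mod_cast h7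
      omega
    rw [hk0, Int.cast_zero, sub_zero] at hk
    obtain ⟨hlt1, hlt2⟩ := abs_lt.mp hk
    exact hz.2 ⟨by linarith, by linarith⟩

end Bridge

end Literature.Barriers.AtomisticToContinuum.HeatConduction

/-! ### The discharge -/

namespace Literature.Barriers.AtomisticToContinuum

open Literature.MathematicalPhysics.KineticTheory.HeatConduction HeatConduction

/-- **Lemma 5.5, eq. (5.20), PROVED.** For the named fact `AjankiHuveneers2011_concentration`
(concentration of `Tⁿu` on `B(y - nw, R√w)` for `u ∈ L¹_{B(y,w)}(𝕋; ℝ₊)`, `wn ≤ 1`): duality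
`∫_I Tⁿu ≥ cⁿ ∫ u · Pⁿ1_I` with the reversed chain `P` (`ccDuality`), and `Pⁿ 1_I ≥ 1/2` on
`B(y, w)` for `R² ≥ 2e(C_q + 1)` (`ccP_iterate_indicator_ge`); `K' = e^{-(2‖h‖_∞ b_* + L)}/2`,
`cⁿ ≥ e^{-(2‖h‖_∞ b_* + L)}` because `wn ≤ 1`. [cite: AjankiHuveneers2011, Lemma 5.5 eq. (5.20)] -/
theorem AjankiHuveneers2011_concentration_holds : AjankiHuveneers2011_concentration := by
  intro τ bm bp hτ h hper hC1
  have hbb : bm ≤ bp := hτ.lt.le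
  have hτm := hτ.measurable
  have hcont : Continuous h := hC1.continuous
  have hhm : Measurable h := hcont.measurable
  obtain ⟨H, hH⟩ : ∃ H : ℝ, ∀ x, |h x| ≤ H := by
    obtain ⟨C, hC⟩ := isBounded_iff_forall_norm_le.mp
      (hper.isBounded_of_continuous one_ne_zero hcont)
    exact ⟨C, fun x => by simpa [Real.norm_eq_abs] using hC (h x) (Set.mem_range_self x)⟩
  have hH0 : 0 ≤ H := (abs_nonneg _).trans (hH 0)
  set M := max |bm| |bp| with hM
  have hM0 : 0 ≤ M := le_max_of_le_left (abs_nonneg _)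
  set Ch := H * M with hCh_def
  have hCh0 : 0 ≤ Ch := by positivity
  have hCh : ∀ x, ∀ b ∈ Set.Icc bm bp, |h x * b| ≤ Ch := fun x b hb => by
    rw [abs_mul]
    exact mul_le_mul (hH x) (ReducedLawHyp.abs_le_of_mem hb) (abs_nonneg _) hH0
  set L := ccL bm bp with hL_def
  have hL0 : 0 ≤ L := ccL_nonneg bm bp
  obtain ⟨w₁, hw₁, hw₁1, Cq, hCq, hLyap⟩ := ccLyapunov_one hτ
  -- the constants
  refine ⟨Real.sqrt (2 * Real.exp 1 * (Cq + 1)), by positivity, fun R hR => ?_⟩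
  have hR0 : 0 < R := lt_of_lt_of_le (by positivity) hR
  have hR2 : 2 * Real.exp 1 * (Cq + 1) ≤ R ^ 2 := by
    calc 2 * Real.exp 1 * (Cq + 1) = Real.sqrt (2 * Real.exp 1 * (Cq + 1)) ^ 2 :=
          (Real.sq_sqrt (by positivity)).symm
      _ ≤ R ^ 2 := pow_le_pow_left₀ (by positivity) hR 2
  set w₀ := min w₁ (min (1 / (48 * π * (1 + M))) (1 / (2 * Ch + 2))) with hw₀_def
  have hw₀pos : 0 < w₀ := by positivity
  refine ⟨w₀, hw₀pos, Real.exp (-(2 * Ch + L)) / 2, by positivity, ?_⟩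
  intro w hw n hn y u hu
  -- the regime
  obtain ⟨hw0, hww₀⟩ := hw
  have hww₁ : w ∈ Set.Ioc 0 w₁ := ⟨hw0, hww₀.trans (min_le_left _ _)⟩
  have hw1 : w ≤ 1 := hww₁.2.trans hw₁1
  have hreg : π * w * (1 + M) ≤ 1 / 48 := by
    have h1 : w ≤ 1 / (48 * π * (1 + M)) := hww₀.trans ((min_le_right _ _).trans (min_le_left _ _))
    calc π * w * (1 + M) ≤ π * (1 / (48 * π * (1 + M))) * (1 + M) := by gcongr
      _ = 1 / 48 := by field_simp
  have hwCh : w ≤ 1 / (2 * Ch + 2) := hww₀.trans ((min_le_right _ _).trans (min_le_right _ _))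
  have hChw2 : Ch * w ≤ 1 / 2 := by
    calc Ch * w ≤ Ch * (1 / (2 * Ch + 2)) := mul_le_mul_of_nonneg_left hwCh hCh0
      _ ≤ 1 / 2 := by
          rw [mul_one_div, div_le_iff₀ (by positivity)]
          linarith
  have hChw : Ch * w ≤ 1 := hChw2.trans (by norm_num)
  have hwhalf : w ≤ 1 / 2 := by
    calc w ≤ 1 / (2 * Ch + 2) := hwCh
      _ ≤ 1 / 2 := div_le_div_of_nonneg_left zero_le_one two_pos (by linarith)
  have hwH : w * H * M ≤ 1 := by
    calc w * H * M = Ch * w := by rw [hCh_def]; ring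
      _ ≤ 1 := hChw
  -- the function `u`
  obtain ⟨Mu, hMu⟩ := hu.bounded
  have hu0 := hu.nonneg
  have hum := hu.measurable
  have hub : ∃ M, ∀ z, |u z| ≤ M := ⟨Mu, fun z => by rw [abs_of_nonneg (hu0 z)]; exact hMu z⟩
  obtain ⟨hTm, ⟨MT, hMT⟩, hT0⟩ := ahT_iterate_closure hτ hhm hH hw0.le hwH hum hub hu0 n
  have hTeq := ccT_iterate_ofReal hτ hhm hH hw0.le hwH hum hub hu0 n
  set Tn := (ahT τ w h)^[n] u with hTn_def
  set I := Set.Ioo (y - n * w - R * Real.sqrt w) (y - n * w + R * Real.sqrt w) with hI_def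
  -- the Bochner integral as a Lebesgue integral
  set J := ∫⁻ z in I, ENNReal.ofReal (Tn z) with hJ_def
  have hJ_eq : ∫ z in I, Tn z = J.toReal :=
    integral_eq_lintegral_of_nonneg_ae (ae_of_all _ hT0) hTm.aestronglyMeasurable
  have hJ_fin : J ≠ ⊤ := by
    have h1 : J ≤ ∫⁻ _ in I, ENNReal.ofReal MT :=
      setLIntegral_mono' measurableSet_Ioo fun z _ =>
        ENNReal.ofReal_le_ofReal ((le_abs_self _).trans (hMT z))
    rw [setLIntegral_const] at h1
    refine ne_of_lt (lt_of_le_of_lt h1 (ENNReal.mul_lt_top ENNReal.ofReal_lt_top ?_))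
    rw [hI_def, Real.volume_Ioo]
    exact ENNReal.ofReal_lt_top
  have hJ_ind : J = ∫⁻ z, I.indicator 1 z * (ccT τ w h)^[n] (fun z => ENNReal.ofReal (u z)) z := by
    rw [hTeq, hJ_def, ← lintegral_indicator measurableSet_Ioo]
    refine lintegral_congr fun z => ?_
    by_cases hz : z ∈ I
    · rw [Set.indicator_of_mem hz, Set.indicator_of_mem hz, Pi.one_apply, one_mul]
    · rw [Set.indicator_of_notMem hz, Set.indicator_of_notMem hz, zero_mul]
  -- duality
  have hmI : Measurable (I.indicator (1 : ℝ → ℝ≥0∞)) := measurable_one.indicator measurableSet_Ioo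
  have hdual := ccDuality hτ hhm hCh hw0 hreg hChw n hum.ennreal_ofReal hmI
  rw [← hJ_ind] at hdual
  -- concentration of the reversed chain on `B(y, w)`
  set c := (1 - Ch * w) / (1 + L * w) with hc_def
  have hlow : ENNReal.ofReal c ^ n * (2⁻¹ * ENNReal.ofReal (ahL1 u)) ≤ J := by
    refine le_trans ?_ hdual
    gcongr
    -- `2⁻¹ ofReal ‖u‖₁ ≤ ∫ u · Pⁿ 1_I`
    have hball : ∀ z ∈ Set.Ioo (y - w) (y + w), ENNReal.ofReal (u z) * 2⁻¹ ≤
        ENNReal.ofReal (u z) * (ccP τ w bm bp)^[n] (I.indicator 1) z := by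
      intro z hz
      refine mul_le_mul' le_rfl ?_
      have hzy : |z - y| < w := abs_lt.mpr ⟨by linarith [hz.1], by linarith [hz.2]⟩
      exact ccP_iterate_indicator_ge hτ hCq hw₁1 hLyap hww₁ hreg hR0 hR2 hn hzy
    have hint_u : IntegrableOn u (Set.Ioo (y - w) (y + w)) := by
      refine Measure.integrableOn_of_bounded (M := Mu) measure_Ioo_lt_top.ne hum.aestronglyMeasurable ?_
      exact ae_of_all _ fun z => by rw [Real.norm_eq_abs, abs_of_nonneg (hu0 z)]; exact hMu z
    calc 2⁻¹ * ENNReal.ofReal (ahL1 u) = 2⁻¹ * ∫⁻ z in Set.Ioo (y - w) (y + w), ENNReal.ofReal (u z) := by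
          rw [ahL1_eq_integral_ball hu hwhalf,
            ofReal_integral_eq_lintegral_ofReal hint_u (ae_of_all _ hu0)]
      _ = ∫⁻ z in Set.Ioo (y - w) (y + w), ENNReal.ofReal (u z) * 2⁻¹ := by
          rw [lintegral_mul_const' _ _ (by simp), mul_comm]
      _ ≤ ∫⁻ z in Set.Ioo (y - w) (y + w),
            ENNReal.ofReal (u z) * (ccP τ w bm bp)^[n] (I.indicator 1) z :=
          setLIntegral_mono' measurableSet_Ioo hball
      _ ≤ ∫⁻ z, ENNReal.ofReal (u z) * (ccP τ w bm bp)^[n] (I.indicator 1) z :=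
          lintegral_mono' Measure.restrict_le_self le_rfl
  -- the constant: `cⁿ ≥ e^{-(2 C_h + L)}`
  have hLw : 0 < 1 + L * w := by
    have := mul_nonneg hL0 hw0.le
    linarith
  have hc0 : 0 ≤ c := div_nonneg (by linarith) hLw.le
  have hc_ge : Real.exp (-(2 * Ch + L) * w) ≤ c := by
    rw [show -(2 * Ch + L) * w = -(2 * Ch * w) + -(L * w) by ring, Real.exp_add]
    have h1 : Real.exp (-(L * w)) ≤ 1 / (1 + L * w) := by
      rw [Real.exp_neg, one_div]
      exact inv_anti₀ hLw (by linarith [Real.add_one_le_exp (L * w)])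
    have h2 : Real.exp (-(2 * Ch * w)) ≤ 1 - Ch * w := by
      have h3 : Real.exp (-(2 * Ch * w)) ≤ 1 / (1 + 2 * Ch * w) := by
        rw [Real.exp_neg, one_div]
        exact inv_anti₀ (by positivity) (by linarith [Real.add_one_le_exp (2 * Ch * w)])
      have h4 : 1 / (1 + 2 * Ch * w) ≤ 1 - Ch * w := by
        rw [div_le_iff₀ (by positivity)]
        have : 0 ≤ Ch * w := by positivity
        nlinarith
      linarith
    calc Real.exp (-(2 * Ch * w)) * Real.exp (-(L * w)) ≤ (1 - Ch * w) * (1 / (1 + L * w)) :=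
          mul_le_mul h2 h1 (Real.exp_pos _).le (by linarith)
      _ = c := by rw [hc_def]; field_simp
  have hcn : Real.exp (-(2 * Ch + L)) ≤ c ^ n := by
    have hCL : 0 ≤ 2 * Ch + L := by positivity
    calc Real.exp (-(2 * Ch + L)) ≤ Real.exp (n * (-(2 * Ch + L) * w)) := by
          refine Real.exp_le_exp.mpr ?_
          have : (2 * Ch + L) * (w * n) ≤ (2 * Ch + L) * 1 := mul_le_mul_of_nonneg_left hn hCL
          nlinarith
      _ = (Real.exp (-(2 * Ch + L) * w)) ^ n := Real.exp_nat_mul _ _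
      _ ≤ c ^ n := pow_le_pow_left₀ (Real.exp_pos _).le hc_ge n
  -- conclusion
  have hL1 : 0 ≤ ahL1 u := integral_nonneg fun z => abs_nonneg _
  have hreal := ENNReal.toReal_mono hJ_fin hlow
  rw [ENNReal.toReal_mul, ENNReal.toReal_mul, ENNReal.toReal_pow, ENNReal.toReal_ofReal hc0,
    ENNReal.toReal_inv, ENNReal.toReal_ofNat, ENNReal.toReal_ofReal hL1] at hreal
  rw [hJ_eq.symm] at hreal
  calc Real.exp (-(2 * Ch + L)) / 2 * ahL1 u ≤ c ^ n / 2 * ahL1 u := by gcongr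
    _ = c ^ n * (2⁻¹ * ahL1 u) := by ring
    _ ≤ ∫ z in I, Tn z := hreal

end Literature.Barriers.AtomisticToContinuum

end
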